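import Summits.QuantumFields.YangMills.Theorems.BalabanUVNodesN11NoTLawAtAnyRegularity
import Literature.MathematicalPhysics.QuantumFieldTheory.Balaban1983to89.B16RLeafRecord13LiveCo

/-!
# DAG node N11 — ★ THE `SLaw`-SIDE (𝐑-SIDE) READING OF `…N11NoTLawAtAnyRegularity`: `¬ SLaw₁₃[Co] θ p 1` AT EVERY LIVE STAGE-13 WITNESS, ANY BACKGROUND,
# NO HYPOTHESIS ON `εreg` — hence Theorem 1's conclusion `densitiesDescribed` and a non-vacuous N11 node FAIL at every world bound to the v1.4 record
# `datumOfRecord₁₃SepCo` of a live witness (in particular the witness of record `theta13LiveOfRecord`), `K ≥ 1`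

Cell `pub-ymgap`, YM-PLAN Track A (HUMAN RULING D-0062), seat `pub-ymgap-dag-n11-e` (g7; R134 fan-out seat N11 [B14], strategy s3 = the 𝐑-side of the located
12a∕def-T junction defect), item K1⁗ `StabilityBAtRecordR13Sep` = stmt-QuantumFields-20290 (helper; director-ym LINE №160 (8) «n11-e continues»).
[III] = [Balaban1988Convergent], [I] = [Balaban1989LargeFieldI], [B7] = [Balaban1985Averaging].

WHAT THIS FILE PROVES (0 `sorry`, 0 `def`, standard axioms; `N`-generic unless marked `su2`).
* §1 ★★★ **`false_of_aeClauses_one`** — the CLAUSE-LEVEL core of seat dag-n11-d's `not_hasSect2FormTAEZ_zero` (same proof, same hypotheses, ANY background map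
  `Ubg`): already the a.e. TWO-BRANCH form «for every new sequence `s′`, either `χ₁(s′) ≠ 0 ⇒ slotT_1(s′) = 0` a.e. or `χ₁(s′) ≠ 0 ⇒ slotT_1(s′) = 𝐓_1(s′)e^{A_1(s′)}[Ubg]`
  a.e.» is contradictory (the 𝐓-laws `LawsT` and `UniversalE` of (S1ᵀ) are never read).  This is EXACTLY the form this lineage's converse
  `…B16RLeafRecord13LiveGeneric.slotsT_succ_aeForm_of_AEZ_succ_of_liveSel_of_rstep` extracts from the POST-𝐑 §2 form `HasSect2FormAEZ … 1 Ubg slots_1` on the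
  live-selector line ([I] p. 177 (i)–(ii): 𝐑 = identity a.e. up to terms of zero fibre mass).  Hence ★★★ **`not_hasSect2FormAEZ_one_of_liveSel_of_rstep`** (any `Ubg`;
  hypotheses: row `rstep`, the selector clause, and dag-n11-d's guards — ζ-unity, `Σ|ζ| ≤ 1`, measurable `U`-sections, `0 < K`, `1 ≤ M`, `1 ≤ M₂`, χ₁-cube side
  `2((d+5)L+3) ≤ sideχ`, [B7] Prop. 1 guard on `a = cR·ε₀(g₀)`, Prop. 2 guards on `β`, `SU(N)` non-trivial at both thresholds) and its two instances
  **`not_sLaw₁₃_one_of_liveSel_of_rstep`** (§2 background `UbgOfRecord₁₃`) ∕ **`not_sLaw₁₃Co_one_of_liveSel_of_rstep`** (print's background `UbgOfRecord₁₃Co`, def-T KEY-21C),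
  and the forms `…_of_hasResidualsOfRecord` (K0b's residuals discharge `rstep` — `…LiveRstep.rstep₁₃_of_liveSel_of_hasResiduals` — and the three ζ-hypotheses).
* §2 AT THE WITNESS OF RECORD `theta13LiveOfRecord` (`εreg = 1`, `cR = 1`, `M = M₂ = 1`; selector clause `rfl`): **`not_sLaw₁₃Co_one_theta13LiveOfRecord`** (general `N`) ∕
  **`…_su2`** (both thresholds `< 2`, n07-e's `su2_dist1_surj`).
* §3 (sequel file `…N11NoDensitiesDescribedAtLiveRecordCo`) the NODE READING at the Co ∕ v1.4 records: `¬ densitiesDescribed` and `B14_main ⇒ ¬ smallCouplings`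
  at every world bound to `datumOfRecord₁₃Co θ h` ∕ `datumOfRecord₁₃SepCo θ h` of a live witness, `K ≥ 1`, the guards.

READING (count-neutral; nothing of Bałaban asserted or refuted).  The 𝐑-side share of N11 at the record (this lineage: the leaf `ROpLeaf`, `TLaw k → SLaw (k+1)`) is
CLOSED on the live line at both backgrounds (`…LiveCo`, p517752); this file shows the (S1ᵀ)-INDEPENDENT obstruction: Theorem 1's level-1 conclusion `SLaw₁₃[Co] θ p 1`
ITSELF is false at every live witness under [B7]'s guards, because the typed §2 slot carries the (2.12)∕(7)-regularity factor on ALL of `Ω₁(s′)ᶜ` (director-ym №160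
FINDING №7, loci L1–L3) — so K1's rung-1 N11 node is not dischargeable non-vacuously at any live v1.4 record, whatever `εreg`, whatever the background (U_old or Co).
The cure is F7 (12a″ `zetaWtP` without `chiRegW` on `Y`; def-R's collar re-range; v1.5 `CoP`), not a choice of `θ`; K1⁗ (an `∃ θ` statement) is NOT refuted; N11 ∕ K1⁗
NOT discharged; typed 28∕28 · discharged 5∕28 UNMOVED.  One finite four-torus at fixed `ε = L^{−K}`; NOT ℝ⁴ ∕ OS ∕ mass gap ∕ Clay.
Sources: [III] Theorem p.245, Thm 1 p.262, (2.10) p.256, (2.17)–(2.18) p.257, (3.16) p.268, (3.24)–(3.25) p.270; [I] (0.3)–(0.4) p.176, (i)–(ii) p.177; [B7] Prop. 1 (51)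
pp.25–26, Prop. 2 (52)–(54) p.26.
-/

noncomputable section

open MeasureTheory ProbabilityTheory
open scoped BigOperators Matrix.Norms.L2Operator ENNReal NNReal

namespace Summit.QuantumFields.YangMills.Theorems.BalabanUVNodesN11NoSLawOneAtAnyLiveWitness

open Literature.MathematicalPhysics.QuantumFieldTheory.Balaban1983to89 T4Continuum Node00 Node00.Tk DagBinding
open Literature.MathematicalPhysics.QuantumFieldTheory.Balaban1983to89.T4AveragingDisintegration (avgDensity)
open Literature.MathematicalPhysics.QuantumFieldTheory.Balaban1983to89.ExpMeanLog (deltaSU)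
open B15Claim189CubePin (cubeOfSite cubeOfSite_mem_cubeIndices)
open GaugeField (plaqHol)
open B15Eq112TorusCover (cover)
open Summit.QuantumFields.YangMills.Theorems.BalabanUVNodesN11AllLargeFieldLabel
  (sideD_pos sideχ_pos transportOfRecord_rhoZero_eq_zero_iff fieldMeasure_preimage_eq_zero_of_avgDensity_ae_zero)
open Summit.QuantumFields.YangMills.BalabanUVNodes.N07Thm1ScaledInterfaceInstance (su2_dist1_surj)
open Summit.QuantumFields.YangMills.Theorems.BalabanUVNodesN11FirstStepFailsAtEveryWitness
open Summit.QuantumFields.YangMills.Theorems.BalabanUVNodesN11NoTLawAtAnyRegularity (cR_theta13LiveOfRecord)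
open B16RLeafRecord13LiveRstep (rstep₁₃_of_liveSel_of_hasResiduals)
open B16RLeafRecord13LiveGeneric (slotsT_succ_aeForm_of_AEZ_succ_of_liveSel_of_rstep)
open B16RLeafRecord13AtLive (liveRepin₁₃_liveSel)

variable {F : T4Family} {N : ℕ} [NeZero N]

/-! ## §1. The clause-level core and `¬ SLaw₁₃[Co] θ p 1` at every live Stage-13 witness -/

section Core

variable (θ : Stage13Params F N) (p : B12.RunParams)

/-- ★★★ **THE a.e. TWO-BRANCH FORM OF THE LEVEL-1 SLOTS IS CONTRADICTORY AT EVERY STAGE-13 WITNESS, FOR EVERY BACKGROUND MAP** (the clause-level core of dag-n11-d's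
`not_hasSect2FormTAEZ_zero`, same proof: §1∕§2 of `…FirstStepFailsAtEveryWitness` kill every summand of `𝐓ρ₀ = Σ χ₁·slotT_1` on the central-rough coarse fields,
K0b's `𝐓ρ₀ = T[ρ₀]` makes `avgDensity = 0` a.e. there, against the positivity of the central-rough event).  Hypotheses: ζ-unity, `Σ|ζ| ≤ 1`, measurable
`U`-sections of the step weights; `0 < K`, `1 ≤ M`, `1 ≤ M₂`, cube side `2((d+5)L+3) ≤ sideχ`; [B7] Prop. 1 guard on `a = cR·ε₀ > 0`, Prop. 2 guards on `β`;
`SU(N)` non-trivial at both thresholds; for SOME term values `t`, energies `E₁`: every `s′` has `χ₁(s′) ≠ 0 ⇒ slotT_1(s′) = 0` a.e. OR `χ₁(s′) ≠ 0 ⇒ slotT_1(s′) =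
sect2Slot(s′)[Ubg]` a.e.  [cite: Balaban1988Convergent, Theorem p.245, (3.25) p.270, (3.1)–(3.5) pp.264–265, (2.10) p.256, (2.21) p.258; Balaban1985Averaging, Prop. 1 (51) pp.25–26, Prop. 2 (52)–(54) p.26, (10) p.19] -/
theorem false_of_aeClauses_one (Ubg : SeqOfRecord F θ.ν θ.τ9.M (gOfRecord₁₃ F N θ p) p.K 1 → BgMap F N p.K)
    (hζ : IsZetaUnity F N θ.ν θ.τ9.M θ.ζ) (hζ' : IsZetaAbsLeOne F N θ.ν θ.τ9.M θ.ζ)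
    (hw : ∀ (s' : SeqOfRecord F θ.ν θ.τ9.M (gOfRecord₁₃ F N θ p) p.K 1) (V' : GaugeField (F.P p.K) 1 (SU N)),
      Measurable (fun U : GaugeField (F.P p.K) 0 (SU N) => wOfRecord F N θ.ν θ.τ9.M θ.A₁ θ.ζ p (gOfRecord₁₃ F N θ p) 0 s' U V'))
    (hK : 0 < p.K) (hMτ : 1 ≤ θ.τ9.M) (hM₂ : 1 ≤ θ.ν.M₂)
    (hS : 2 * ((((F.P p.K).d + 4) * (F.P p.K).L + 2) + (F.P p.K).L + 1) ≤ sideχ F θ.ν p (gOfRecord₁₃ F N θ p) 0)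
    (ha : 0 < θ.s2.cR * epsOfRecord θ.ν (gOfRecord₁₃ F N θ p) 0)
    (has : ((((F.P p.K).d + 4) * (F.P p.K).L : ℕ) : ℝ) ^ 2 / 4 * (θ.s2.cR * epsOfRecord θ.ν (gOfRecord₁₃ F N θ p) 0) ≤ deltaSU (Fin N) / 2)
    {β : ℝ} (hβ : 0 < β) (hβ3 : (143 * (((((F.P p.K).d + 4 : ℕ) : ℝ)) ^ 2 / 4) ^ 2) * β ≤ 1 / 3)
    (hβ2 : 2 * β ≤ 2 * deltaSU (Fin N) / ((((F.P p.K).d + 4) * (F.P p.K).L : ℕ) : ℝ) ^ 2)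
    (hβε : epsOfRecord θ.ν (gOfRecord₁₃ F N θ p) 1 * (F.P p.K).eta 1 ^ 2 + 4 * (2 * deltaOfRecord θ.ν (gOfRecord₁₃ F N θ p) 0 θ.A₁) ≤
      β * (F.P p.K).eta 1 ^ 2)
    (hg : ∃ g₀ : SU N,
      ((F.P p.K).L : ℝ) ^ 2 * (θ.s2.cR * epsOfRecord θ.ν (gOfRecord₁₃ F N θ p) 0) +
          143 * (((((F.P p.K).d + 4) * (F.P p.K).L : ℕ) : ℝ) ^ 2 / 4 * (θ.s2.cR * epsOfRecord θ.ν (gOfRecord₁₃ F N θ p) 0)) ^ 2 < dist1 g₀ ∧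
        2 * β < dist1 g₀)
    (t : SeqOfRecord F θ.ν θ.τ9.M (gOfRecord₁₃ F N θ p) p.K 1 → Sect2.TermValues (F.P p.K) (MatA N) (FluctV N) θ.τ9.M)
    (Ek : SeqOfRecord F θ.ν θ.τ9.M (gOfRecord₁₃ F N θ p) p.K 1 → ℝ)
    (hC : ∀ s : SeqOfRecord F θ.ν θ.τ9.M (gOfRecord₁₃ F N θ p) p.K 1,
      (∀ᵐ V1 ∂fieldMeasure (F.P p.K) 1 (SU N), chiSeqOfRecord F N θ.ν θ.τ9.M (gOfRecord₁₃ F N θ p) p.K 1 s V1 ≠ 0 →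
          slotsTOfRecord F N θ.ν θ.τ9 (EOfRecord₁₃ F N θ) (wOfRecord₉ F N θ.toStage9Params) θ.ppSel p (gOfRecord₁₃ F N θ p) 1 s V1 = 0) ∨
        ∀ᵐ V1 ∂fieldMeasure (F.P p.K) 1 (SU N), chiSeqOfRecord F N θ.ν θ.τ9.M (gOfRecord₁₃ F N θ p) p.K 1 s V1 ≠ 0 →
          slotsTOfRecord F N θ.ν θ.τ9 (EOfRecord₁₃ F N θ) (wOfRecord₉ F N θ.toStage9Params) θ.ppSel p (gOfRecord₁₃ F N θ p) 1 s V1 =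
            sect2Slot F N (FluctV N) p.K (settingOfRecord₁₃ F N θ p) (θ.Rz p.K) (WtOfRecord₁₃ F N θ p) s (t s) (Ek s) (Ubg s) V1) :
    False := by
  classical
  -- the two thresholds and their maximum
  set T₁ : ℝ := ((F.P p.K).L : ℝ) ^ 2 * (θ.s2.cR * epsOfRecord θ.ν (gOfRecord₁₃ F N θ p) 0) +
      143 * (((((F.P p.K).d + 4) * (F.P p.K).L : ℕ) : ℝ) ^ 2 / 4 * (θ.s2.cR * epsOfRecord θ.ν (gOfRecord₁₃ F N θ p) 0)) ^ 2 with hT₁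
  set T : ℝ := max T₁ (2 * β) with hTdef
  obtain ⟨g₀, hg₁, hg₂⟩ := hg
  have hTlt : T < dist1 g₀ := max_lt hg₁ hg₂
  have hD := sideD_pos (F := F) θ.ν hMτ p (gOfRecord₁₃ F N θ p) 0
  have hχ := sideχ_pos (F := F) hM₂ p (gOfRecord₁₃ F N θ p) 0
  -- (A) the §2-form slot of every `s′` dies on the central-rough fields of every cube in `Ω₁(s′)ᶜ`
  have hA : ∀ᵐ V1 ∂fieldMeasure (F.P p.K) 1 (SU N), ∀ (s : SeqOfRecord F θ.ν θ.τ9.M (gOfRecord₁₃ F N θ p) p.K 1) (c : Iχ F θ.ν p (gOfRecord₁₃ F N θ p) 0)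
      (q : Plaq (F.P p.K) 1), cubeχ F θ.ν p (gOfRecord₁₃ F N θ p) 0 c ⊆ (s.Ω 1)ᶜ →
      q.src = blockOf (cover (F.P p.K) (fun i => ((sideχ F θ.ν p (gOfRecord₁₃ F N θ p) 0 : ℕ) : ℤ) * (c : B14DomainGeom.Pt (F.P p.K).d) i +
        ((sideχ F θ.ν p (gOfRecord₁₃ F N θ p) 0 / 2 : ℕ) : ℤ))) →
      T ≤ dist1 (plaqHol V1 q) →
        sect2Slot F N (FluctV N) p.K (settingOfRecord₁₃ F N θ p) (θ.Rz p.K) (WtOfRecord₁₃ F N θ p) s (t s) (Ek s) (Ubg s) V1 = 0 := by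
    refine ae_all_iff.2 fun s => ae_all_iff.2 fun c => ae_all_iff.2 fun q => ?_
    by_cases hc : cubeχ F θ.ν p (gOfRecord₁₃ F N θ p) 0 c ⊆ (s.Ω 1)ᶜ
    · by_cases hq : q.src = blockOf (cover (F.P p.K) (fun i => ((sideχ F θ.ν p (gOfRecord₁₃ F N θ p) 0 : ℕ) : ℤ) * (c : B14DomainGeom.Pt (F.P p.K).d) i +
          ((sideχ F θ.ν p (gOfRecord₁₃ F N θ p) 0 / 2 : ℕ) : ℤ)))
      · filter_upwards [sect2Slot_one_ae_zero_on_centralRough₁₃ θ p (T := T) ha has (hT₁ ▸ le_max_left _ _) hS s hc hq (t s) (Ek s)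
          (Ubg s)] with V1 hV1 _ _ hr
        exact hV1 hr
      · exact Filter.Eventually.of_forall fun V1 _ hq' => absurd hq' hq
    · exact Filter.Eventually.of_forall fun V1 hc' => absurd hc' hc
  -- (B) the sequences reached only by `(∅,∅)`-labels die on the rough fields
  have hB := slotsT_one_ae_zero_of_emptyLabels₁₃ θ p hχ hβ hβ3 hβ2 hβε
  -- (C) the a.e. two-branch clauses, all sequences at once, in pointwise form
  have hC' : ∀ᵐ V1 ∂fieldMeasure (F.P p.K) 1 (SU N), ∀ s : SeqOfRecord F θ.ν θ.τ9.M (gOfRecord₁₃ F N θ p) p.K 1,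
      chiSeqOfRecord F N θ.ν θ.τ9.M (gOfRecord₁₃ F N θ p) p.K 1 s V1 ≠ 0 →
        slotsTOfRecord F N θ.ν θ.τ9 (EOfRecord₁₃ F N θ) (wOfRecord₉ F N θ.toStage9Params) θ.ppSel p (gOfRecord₁₃ F N θ p) 1 s V1 = 0 ∨
          slotsTOfRecord F N θ.ν θ.τ9 (EOfRecord₁₃ F N θ) (wOfRecord₉ F N θ.toStage9Params) θ.ppSel p (gOfRecord₁₃ F N θ p) 1 s V1 =
            sect2Slot F N (FluctV N) p.K (settingOfRecord₁₃ F N θ p) (θ.Rz p.K) (WtOfRecord₁₃ F N θ p) s (t s) (Ek s) (Ubg s) V1 := by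
    refine ae_all_iff.2 fun s => ?_
    rcases hC s with h0 | hid
    · filter_upwards [h0] with V1 hV1 using fun hne => Or.inl (hV1 hne)
    · filter_upwards [hid] with V1 hV1 using fun hne => Or.inr (hV1 hne)
  -- a cube (the family is nonempty)
  set c₀ : Iχ F θ.ν p (gOfRecord₁₃ F N θ p) 0 :=
    ⟨cubeOfSite (sideχ F θ.ν p (gOfRecord₁₃ F N θ p) 0) (fun _ => 0), cubeOfSite_mem_cubeIndices _ hχ _⟩ with hc₀
  -- hence `avgDensity = 0` a.e. on the central-rough coarse fields
  have hae : ∀ᵐ V1 ∂fieldMeasure (F.P p.K) 1 (SU N), (∀ c : Iχ F θ.ν p (gOfRecord₁₃ F N θ p) 0, ∃ q : Plaq (F.P p.K) 1,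
      q.src = blockOf (cover (F.P p.K) (fun i => ((sideχ F θ.ν p (gOfRecord₁₃ F N θ p) 0 : ℕ) : ℤ) * (c : B14DomainGeom.Pt (F.P p.K).d) i +
        ((sideχ F θ.ν p (gOfRecord₁₃ F N θ p) 0 / 2 : ℕ) : ℤ))) ∧
        T ≤ dist1 (plaqHol V1 q)) → True → (avgDensity (avOfRecord F N p.K 0).avg V1 : ℝ) = 0 := by
    filter_upwards [hA, hB, hC'] with V1 hAV hBV hCV hrough _
    -- every summand of the 𝐓-image density vanishes at `V₁`
    have hzero : ∀ s : SeqOfRecord F θ.ν θ.τ9.M (gOfRecord₁₃ F N θ p) p.K 1,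
        chiSeqOfRecord F N θ.ν θ.τ9.M (gOfRecord₁₃ F N θ p) p.K 1 s V1 *
          slotsTOfRecord F N θ.ν θ.τ9 (EOfRecord₁₃ F N θ) (wOfRecord₉ F N θ.toStage9Params) θ.ppSel p (gOfRecord₁₃ F N θ p) 1 s V1 = 0 := by
      intro s
      by_cases hχ0 : chiSeqOfRecord F N θ.ν θ.τ9.M (gOfRecord₁₃ F N θ p) p.K 1 s V1 = 0
      · rw [hχ0, zero_mul]
      rcases hCV s hχ0 with h0 | hid
      · rw [h0, mul_zero]
      by_cases hlab : ∀ tt : LbOfRecord F θ.ν p (gOfRecord₁₃ F N θ p) 0,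
          σOfRecord F θ.ν θ.τ9.M p (gOfRecord₁₃ F N θ p) 0 s.init tt = s → tt.1 = ∅ ∧ tt.2.1 = ∅
      · obtain ⟨q₀, -, hq₀⟩ := hrough c₀
        rw [hBV s q₀ hlab ((le_max_right _ _).trans hq₀), mul_zero]
      · push Not at hlab
        obtain ⟨tt, htt, hne⟩ := hlab
        have hne' : tt.1 ≠ ∅ ∨ tt.2.1 ≠ ∅ := by
          by_cases h1 : tt.1 = ∅
          · exact Or.inr (hne h1).ne_empty
          · exact Or.inl h1
        obtain ⟨c, hc⟩ := exists_cubeχ_subset_compl_OmegaOfLabel F θ.ν θ.τ9.M p (gOfRecord₁₃ F N θ p) 0 hD s.init tt hne'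
        have hΩeq : (σOfRecord F θ.ν θ.τ9.M p (gOfRecord₁₃ F N θ p) 0 s.init tt).Ω (0 + 1) =
            OmegaOfLabel F θ.ν θ.τ9.M p (gOfRecord₁₃ F N θ p) 0 s.init tt :=
          σOfRecord_Ω_succ F θ.ν θ.τ9.M p (gOfRecord₁₃ F N θ p) 0 s.init tt
        rw [htt] at hΩeq
        have hc' : cubeχ F θ.ν p (gOfRecord₁₃ F N θ p) 0 c ⊆ (s.Ω 1)ᶜ := by
          rw [show s.Ω 1 = s.Ω (0 + 1) from rfl, hΩeq]; exact hc
        obtain ⟨q, hq, hqr⟩ := hrough c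
        rw [hid, hAV s c q hc' hq hqr, mul_zero]
    -- the sum of the summands is the 𝐓-image density, which IS the transport of `ρ₀` (K0b)
    have hsum : tdensOfRecord₁₃ F N θ p 0 V1 = ∑ s : SeqOfRecord F θ.ν θ.τ9.M (gOfRecord₁₃ F N θ p) p.K 1,
        chiSeqOfRecord F N θ.ν θ.τ9.M (gOfRecord₁₃ F N θ p) p.K 1 s V1 *
          slotsTOfRecord F N θ.ν θ.τ9 (EOfRecord₁₃ F N θ) (wOfRecord₉ F N θ.toStage9Params) θ.ppSel p (gOfRecord₁₃ F N θ p) 1 s V1 := rfl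
    have htr : tdensOfRecord₁₃ F N θ p 0 V1 =
        transportOfRecord F N p.K 0 (rhoZeroOfRecord F N p.K ((gOfRecord₁₃ F N θ p) 0) (EOfRecord₁₃ F N θ p)) V1 :=
      trhoOfRecord9_zero_eq_transport F N θ.ν θ.τ9 θ.A₁ hζ hζ' (EOfRecord₁₃ F N θ) θ.ppSel p (gOfRecord₁₃ F N θ p) hw V1
    have h0 : transportOfRecord F N p.K 0 (rhoZeroOfRecord F N p.K ((gOfRecord₁₃ F N θ p) 0) (EOfRecord₁₃ F N θ p)) V1 = 0 := by
      rw [← htr, hsum]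
      exact Finset.sum_eq_zero fun s _ => hzero s
    exact (transportOfRecord_rhoZero_eq_zero_iff p.K _ _ V1).1 h0
  -- … so the central-rough coarse fields have a preimage of Haar measure zero — against their positivity
  have hzero := fieldMeasure_preimage_eq_zero_of_avgDensity_ae_zero p hK hae
    (measurableSet_centralRough F N θ.ν p (gOfRecord₁₃ F N θ p) T) (fun V1 hV1 => hV1) (fun _ _ => trivial)
  exact (fieldMeasure_preimage_centralRough_pos F N θ.ν p (gOfRecord₁₃ F N θ p) g₀ hTlt).ne' hzero

/-- ★★★ **ON THE LIVE-SELECTOR LINE THE POST-𝐑 §2 FORM OF `ρ₁` IS FALSE AT EVERY STAGE-13 WITNESS, FOR EVERY BACKGROUND MAP** (row `rstep` + the selector clause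
give the a.e. two-branch form of the level-1 𝐓-slots — this lineage's converse `…LiveGeneric.slotsT_succ_aeForm_of_AEZ_succ_of_liveSel_of_rstep`; then
`false_of_aeClauses_one`).  [cite: Balaban1988Convergent, Theorem p.245, Thm 1 p.262, (2.17)–(2.18) p.257, (3.24)–(3.25) p.270; Balaban1989LargeFieldI, (0.3)–(0.4) p.176, p.177 (i)–(ii); Balaban1985Averaging, Prop. 1 (51) pp.25–26, Prop. 2 (52)–(54) p.26] -/
theorem not_hasSect2FormAEZ_one_of_liveSel_of_rstep
    (hrstep : ∀ (p : B12.RunParams) (k : ℕ) [DecidableEq (PBond (F.P p.K) (k + 1))], k < p.K →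
      (towerRepOfRecord F N θ.ν θ.τ9 (slotsTOfRecord F N θ.ν θ.τ9 (EOfRecord₁₃ F N θ) (wOfRecord₉ F N θ.toStage9Params) θ.ppSel)
        θ.ppSel p (gOfRecord₁₃ F N θ p) (k + 1)).toRepData.ProvisosInt)
    (hsel : θ.ppSel = ppSelLiveOfRecord F N θ.ν θ.τ9 (EOfRecord₁₃ F N θ) (wOfRecord₉ F N θ.toStage9Params))
    (Ubg : SeqOfRecord F θ.ν θ.τ9.M (gOfRecord₁₃ F N θ p) p.K 1 → BgMap F N p.K)
    (hζ : IsZetaUnity F N θ.ν θ.τ9.M θ.ζ) (hζ' : IsZetaAbsLeOne F N θ.ν θ.τ9.M θ.ζ)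
    (hw : ∀ (s' : SeqOfRecord F θ.ν θ.τ9.M (gOfRecord₁₃ F N θ p) p.K 1) (V' : GaugeField (F.P p.K) 1 (SU N)),
      Measurable (fun U : GaugeField (F.P p.K) 0 (SU N) => wOfRecord F N θ.ν θ.τ9.M θ.A₁ θ.ζ p (gOfRecord₁₃ F N θ p) 0 s' U V'))
    (hK : 0 < p.K) (hMτ : 1 ≤ θ.τ9.M) (hM₂ : 1 ≤ θ.ν.M₂)
    (hS : 2 * ((((F.P p.K).d + 4) * (F.P p.K).L + 2) + (F.P p.K).L + 1) ≤ sideχ F θ.ν p (gOfRecord₁₃ F N θ p) 0)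
    (ha : 0 < θ.s2.cR * epsOfRecord θ.ν (gOfRecord₁₃ F N θ p) 0)
    (has : ((((F.P p.K).d + 4) * (F.P p.K).L : ℕ) : ℝ) ^ 2 / 4 * (θ.s2.cR * epsOfRecord θ.ν (gOfRecord₁₃ F N θ p) 0) ≤ deltaSU (Fin N) / 2)
    {β : ℝ} (hβ : 0 < β) (hβ3 : (143 * (((((F.P p.K).d + 4 : ℕ) : ℝ)) ^ 2 / 4) ^ 2) * β ≤ 1 / 3)
    (hβ2 : 2 * β ≤ 2 * deltaSU (Fin N) / ((((F.P p.K).d + 4) * (F.P p.K).L : ℕ) : ℝ) ^ 2)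
    (hβε : epsOfRecord θ.ν (gOfRecord₁₃ F N θ p) 1 * (F.P p.K).eta 1 ^ 2 + 4 * (2 * deltaOfRecord θ.ν (gOfRecord₁₃ F N θ p) 0 θ.A₁) ≤
      β * (F.P p.K).eta 1 ^ 2)
    (hg : ∃ g₀ : SU N,
      ((F.P p.K).L : ℝ) ^ 2 * (θ.s2.cR * epsOfRecord θ.ν (gOfRecord₁₃ F N θ p) 0) +
          143 * (((((F.P p.K).d + 4) * (F.P p.K).L : ℕ) : ℝ) ^ 2 / 4 * (θ.s2.cR * epsOfRecord θ.ν (gOfRecord₁₃ F N θ p) 0)) ^ 2 < dist1 g₀ ∧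
        2 * β < dist1 g₀) :
    ¬ HasSect2FormAEZ F N (FluctV N) p.K (settingOfRecord₁₃ F N θ p) (θ.Rz p.K) (WtOfRecord₁₃ F N θ p) 1 Ubg
      (slotsOfRecord F N θ.ν θ.τ9 (EOfRecord₁₃ F N θ) (wOfRecord₉ F N θ.toStage9Params) θ.ppSel p (gOfRecord₁₃ F N θ p) 1) := fun hS1 => by
  obtain ⟨t, Ek, -, hs⟩ := slotsT_succ_aeForm_of_AEZ_succ_of_liveSel_of_rstep F N θ p hrstep hsel 0 hK Ubg hS1
  exact false_of_aeClauses_one θ p Ubg hζ hζ' hw hK hMτ hM₂ hS ha has hβ hβ3 hβ2 hβε hg t Ek fun s => (hs s).2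

/-- ★★★ **`¬ SLaw₁₃ θ p 1` ON THE LIVE LINE AT EVERY STAGE-13 WITNESS** (def-R's multi-scale background `UbgOfRecord₁₃`; row `rstep`, selector clause, dag-n11-d's
guards) — NO hypothesis on `εreg`. [cite: Balaban1988Convergent, Theorem p.245, Thm 1 p.262, (3.25) p.270; Balaban1989LargeFieldI, (0.3)–(0.4) p.176; Balaban1985Averaging, Prop. 1 (51) pp.25–26, Prop. 2 (52)–(54) p.26] -/
theorem not_sLaw₁₃_one_of_liveSel_of_rstep
    (hrstep : ∀ (p : B12.RunParams) (k : ℕ) [DecidableEq (PBond (F.P p.K) (k + 1))], k < p.K →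
      (towerRepOfRecord F N θ.ν θ.τ9 (slotsTOfRecord F N θ.ν θ.τ9 (EOfRecord₁₃ F N θ) (wOfRecord₉ F N θ.toStage9Params) θ.ppSel)
        θ.ppSel p (gOfRecord₁₃ F N θ p) (k + 1)).toRepData.ProvisosInt)
    (hsel : θ.ppSel = ppSelLiveOfRecord F N θ.ν θ.τ9 (EOfRecord₁₃ F N θ) (wOfRecord₉ F N θ.toStage9Params))
    (hζ : IsZetaUnity F N θ.ν θ.τ9.M θ.ζ) (hζ' : IsZetaAbsLeOne F N θ.ν θ.τ9.M θ.ζ)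
    (hw : ∀ (s' : SeqOfRecord F θ.ν θ.τ9.M (gOfRecord₁₃ F N θ p) p.K 1) (V' : GaugeField (F.P p.K) 1 (SU N)),
      Measurable (fun U : GaugeField (F.P p.K) 0 (SU N) => wOfRecord F N θ.ν θ.τ9.M θ.A₁ θ.ζ p (gOfRecord₁₃ F N θ p) 0 s' U V'))
    (hK : 0 < p.K) (hMτ : 1 ≤ θ.τ9.M) (hM₂ : 1 ≤ θ.ν.M₂)
    (hS : 2 * ((((F.P p.K).d + 4) * (F.P p.K).L + 2) + (F.P p.K).L + 1) ≤ sideχ F θ.ν p (gOfRecord₁₃ F N θ p) 0)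
    (ha : 0 < θ.s2.cR * epsOfRecord θ.ν (gOfRecord₁₃ F N θ p) 0)
    (has : ((((F.P p.K).d + 4) * (F.P p.K).L : ℕ) : ℝ) ^ 2 / 4 * (θ.s2.cR * epsOfRecord θ.ν (gOfRecord₁₃ F N θ p) 0) ≤ deltaSU (Fin N) / 2)
    {β : ℝ} (hβ : 0 < β) (hβ3 : (143 * (((((F.P p.K).d + 4 : ℕ) : ℝ)) ^ 2 / 4) ^ 2) * β ≤ 1 / 3)
    (hβ2 : 2 * β ≤ 2 * deltaSU (Fin N) / ((((F.P p.K).d + 4) * (F.P p.K).L : ℕ) : ℝ) ^ 2)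
    (hβε : epsOfRecord θ.ν (gOfRecord₁₃ F N θ p) 1 * (F.P p.K).eta 1 ^ 2 + 4 * (2 * deltaOfRecord θ.ν (gOfRecord₁₃ F N θ p) 0 θ.A₁) ≤
      β * (F.P p.K).eta 1 ^ 2)
    (hg : ∃ g₀ : SU N,
      ((F.P p.K).L : ℝ) ^ 2 * (θ.s2.cR * epsOfRecord θ.ν (gOfRecord₁₃ F N θ p) 0) +
          143 * (((((F.P p.K).d + 4) * (F.P p.K).L : ℕ) : ℝ) ^ 2 / 4 * (θ.s2.cR * epsOfRecord θ.ν (gOfRecord₁₃ F N θ p) 0)) ^ 2 < dist1 g₀ ∧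
        2 * β < dist1 g₀) :
    ¬ SLaw₁₃ F N θ p 1 := fun h =>
  not_hasSect2FormAEZ_one_of_liveSel_of_rstep θ p hrstep hsel _ hζ hζ' hw hK hMτ hM₂ hS ha has hβ hβ3 hβ2 hβε hg ((sLaw₁₃_iff F N θ p 1).mp h)

/-- ★★★ **`¬ SLaw₁₃Co θ p 1` ON THE LIVE LINE AT EVERY STAGE-13 WITNESS — PRINT'S BACKGROUND `UbgOfRecord₁₃Co`** (node00-def-T KEY-21C; same hypotheses).
[cite: Balaban1988Convergent, Theorem p.245, Thm 1 p.262, (3.25) p.270; Balaban1989LargeFieldI, (0.3)–(0.4) p.176; Balaban1985Averaging, Prop. 1 (51) pp.25–26, Prop. 2 (52)–(54) p.26; Balaban1985RegularSpaces, (6) p.77] -/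
theorem not_sLaw₁₃Co_one_of_liveSel_of_rstep
    (hrstep : ∀ (p : B12.RunParams) (k : ℕ) [DecidableEq (PBond (F.P p.K) (k + 1))], k < p.K →
      (towerRepOfRecord F N θ.ν θ.τ9 (slotsTOfRecord F N θ.ν θ.τ9 (EOfRecord₁₃ F N θ) (wOfRecord₉ F N θ.toStage9Params) θ.ppSel)
        θ.ppSel p (gOfRecord₁₃ F N θ p) (k + 1)).toRepData.ProvisosInt)
    (hsel : θ.ppSel = ppSelLiveOfRecord F N θ.ν θ.τ9 (EOfRecord₁₃ F N θ) (wOfRecord₉ F N θ.toStage9Params))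
    (hζ : IsZetaUnity F N θ.ν θ.τ9.M θ.ζ) (hζ' : IsZetaAbsLeOne F N θ.ν θ.τ9.M θ.ζ)
    (hw : ∀ (s' : SeqOfRecord F θ.ν θ.τ9.M (gOfRecord₁₃ F N θ p) p.K 1) (V' : GaugeField (F.P p.K) 1 (SU N)),
      Measurable (fun U : GaugeField (F.P p.K) 0 (SU N) => wOfRecord F N θ.ν θ.τ9.M θ.A₁ θ.ζ p (gOfRecord₁₃ F N θ p) 0 s' U V'))
    (hK : 0 < p.K) (hMτ : 1 ≤ θ.τ9.M) (hM₂ : 1 ≤ θ.ν.M₂)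
    (hS : 2 * ((((F.P p.K).d + 4) * (F.P p.K).L + 2) + (F.P p.K).L + 1) ≤ sideχ F θ.ν p (gOfRecord₁₃ F N θ p) 0)
    (ha : 0 < θ.s2.cR * epsOfRecord θ.ν (gOfRecord₁₃ F N θ p) 0)
    (has : ((((F.P p.K).d + 4) * (F.P p.K).L : ℕ) : ℝ) ^ 2 / 4 * (θ.s2.cR * epsOfRecord θ.ν (gOfRecord₁₃ F N θ p) 0) ≤ deltaSU (Fin N) / 2)
    {β : ℝ} (hβ : 0 < β) (hβ3 : (143 * (((((F.P p.K).d + 4 : ℕ) : ℝ)) ^ 2 / 4) ^ 2) * β ≤ 1 / 3)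
    (hβ2 : 2 * β ≤ 2 * deltaSU (Fin N) / ((((F.P p.K).d + 4) * (F.P p.K).L : ℕ) : ℝ) ^ 2)
    (hβε : epsOfRecord θ.ν (gOfRecord₁₃ F N θ p) 1 * (F.P p.K).eta 1 ^ 2 + 4 * (2 * deltaOfRecord θ.ν (gOfRecord₁₃ F N θ p) 0 θ.A₁) ≤
      β * (F.P p.K).eta 1 ^ 2)
    (hg : ∃ g₀ : SU N,
      ((F.P p.K).L : ℝ) ^ 2 * (θ.s2.cR * epsOfRecord θ.ν (gOfRecord₁₃ F N θ p) 0) +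
          143 * (((((F.P p.K).d + 4) * (F.P p.K).L : ℕ) : ℝ) ^ 2 / 4 * (θ.s2.cR * epsOfRecord θ.ν (gOfRecord₁₃ F N θ p) 0)) ^ 2 < dist1 g₀ ∧
        2 * β < dist1 g₀) :
    ¬ SLaw₁₃Co F N θ p 1 := fun h =>
  not_hasSect2FormAEZ_one_of_liveSel_of_rstep θ p hrstep hsel _ hζ hζ' hw hK hMτ hM₂ hS ha has hβ hβ3 hβ2 hβε hg ((sLaw₁₃Co_iff F N θ p 1).mp h)

/-- **`¬ SLaw₁₃Co θ p 1` ON THE LIVE LINE FROM K0b's RESIDUALS** (`θ.HasResidualsOfRecord` discharges row `rstep` — `…LiveRstep.rstep₁₃_of_liveSel_of_hasResiduals` — and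
the three ζ-hypotheses; the run's guards displayed). [cite: Balaban1988Convergent, Theorem p.245, Thm 1 p.262, (3.16) p.268, (3.25) p.270; Balaban1989LargeFieldI, (0.3)–(0.4) p.176; Balaban1985Averaging, Prop. 1 (51) pp.25–26, Prop. 2 (52)–(54) p.26] -/
theorem not_sLaw₁₃Co_one_of_liveSel_of_hasResiduals (hres : θ.HasResidualsOfRecord F N)
    (hsel : θ.ppSel = ppSelLiveOfRecord F N θ.ν θ.τ9 (EOfRecord₁₃ F N θ) (wOfRecord₉ F N θ.toStage9Params))
    (hK : 0 < p.K) (hMτ : 1 ≤ θ.τ9.M) (hM₂ : 1 ≤ θ.ν.M₂)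
    (hS : 2 * ((((F.P p.K).d + 4) * (F.P p.K).L + 2) + (F.P p.K).L + 1) ≤ sideχ F θ.ν p (gOfRecord₁₃ F N θ p) 0)
    (ha : 0 < θ.s2.cR * epsOfRecord θ.ν (gOfRecord₁₃ F N θ p) 0)
    (has : ((((F.P p.K).d + 4) * (F.P p.K).L : ℕ) : ℝ) ^ 2 / 4 * (θ.s2.cR * epsOfRecord θ.ν (gOfRecord₁₃ F N θ p) 0) ≤ deltaSU (Fin N) / 2)
    {β : ℝ} (hβ : 0 < β) (hβ3 : (143 * (((((F.P p.K).d + 4 : ℕ) : ℝ)) ^ 2 / 4) ^ 2) * β ≤ 1 / 3)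
    (hβ2 : 2 * β ≤ 2 * deltaSU (Fin N) / ((((F.P p.K).d + 4) * (F.P p.K).L : ℕ) : ℝ) ^ 2)
    (hβε : epsOfRecord θ.ν (gOfRecord₁₃ F N θ p) 1 * (F.P p.K).eta 1 ^ 2 + 4 * (2 * deltaOfRecord θ.ν (gOfRecord₁₃ F N θ p) 0 θ.A₁) ≤
      β * (F.P p.K).eta 1 ^ 2)
    (hg : ∃ g₀ : SU N,
      ((F.P p.K).L : ℝ) ^ 2 * (θ.s2.cR * epsOfRecord θ.ν (gOfRecord₁₃ F N θ p) 0) +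
          143 * (((((F.P p.K).d + 4) * (F.P p.K).L : ℕ) : ℝ) ^ 2 / 4 * (θ.s2.cR * epsOfRecord θ.ν (gOfRecord₁₃ F N θ p) 0)) ^ 2 < dist1 g₀ ∧
        2 * β < dist1 g₀) :
    ¬ SLaw₁₃Co F N θ p 1 := by
  refine not_sLaw₁₃Co_one_of_liveSel_of_rstep θ p (rstep₁₃_of_liveSel_of_hasResiduals hsel hres) hsel hres.zetaUnity hres.zetaAbs
    (fun s' V' => ?_) hK hMτ hM₂ hS ha has hβ hβ3 hβ2 hβε hg
  rw [hres.zeta_eq]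
  exact measurable_wOfRecord_zeta316_section θ.A₁ s' V'

/-- **`¬ SLaw₁₃ θ p 1` ON THE LIVE LINE FROM K0b's RESIDUALS** (§2 background; strengthens this seat's `…LiveRecordFirstLevelFails.not_sLaw₁₃_one_of_liveSel_of_small_εreg`:
NO hypothesis on `εreg`). [cite: Balaban1988Convergent, Theorem p.245, Thm 1 p.262, (3.16) p.268, (3.25) p.270; Balaban1989LargeFieldI, (0.3)–(0.4) p.176; Balaban1985Averaging, Prop. 1 (51) pp.25–26, Prop. 2 (52)–(54) p.26] -/
theorem not_sLaw₁₃_one_of_liveSel_of_hasResiduals (hres : θ.HasResidualsOfRecord F N)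
    (hsel : θ.ppSel = ppSelLiveOfRecord F N θ.ν θ.τ9 (EOfRecord₁₃ F N θ) (wOfRecord₉ F N θ.toStage9Params))
    (hK : 0 < p.K) (hMτ : 1 ≤ θ.τ9.M) (hM₂ : 1 ≤ θ.ν.M₂)
    (hS : 2 * ((((F.P p.K).d + 4) * (F.P p.K).L + 2) + (F.P p.K).L + 1) ≤ sideχ F θ.ν p (gOfRecord₁₃ F N θ p) 0)
    (ha : 0 < θ.s2.cR * epsOfRecord θ.ν (gOfRecord₁₃ F N θ p) 0)
    (has : ((((F.P p.K).d + 4) * (F.P p.K).L : ℕ) : ℝ) ^ 2 / 4 * (θ.s2.cR * epsOfRecord θ.ν (gOfRecord₁₃ F N θ p) 0) ≤ deltaSU (Fin N) / 2)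
    {β : ℝ} (hβ : 0 < β) (hβ3 : (143 * (((((F.P p.K).d + 4 : ℕ) : ℝ)) ^ 2 / 4) ^ 2) * β ≤ 1 / 3)
    (hβ2 : 2 * β ≤ 2 * deltaSU (Fin N) / ((((F.P p.K).d + 4) * (F.P p.K).L : ℕ) : ℝ) ^ 2)
    (hβε : epsOfRecord θ.ν (gOfRecord₁₃ F N θ p) 1 * (F.P p.K).eta 1 ^ 2 + 4 * (2 * deltaOfRecord θ.ν (gOfRecord₁₃ F N θ p) 0 θ.A₁) ≤
      β * (F.P p.K).eta 1 ^ 2)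
    (hg : ∃ g₀ : SU N,
      ((F.P p.K).L : ℝ) ^ 2 * (θ.s2.cR * epsOfRecord θ.ν (gOfRecord₁₃ F N θ p) 0) +
          143 * (((((F.P p.K).d + 4) * (F.P p.K).L : ℕ) : ℝ) ^ 2 / 4 * (θ.s2.cR * epsOfRecord θ.ν (gOfRecord₁₃ F N θ p) 0)) ^ 2 < dist1 g₀ ∧
        2 * β < dist1 g₀) :
    ¬ SLaw₁₃ F N θ p 1 := by
  refine not_sLaw₁₃_one_of_liveSel_of_rstep θ p (rstep₁₃_of_liveSel_of_hasResiduals hsel hres) hsel hres.zetaUnity hres.zetaAbs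
    (fun s' V' => ?_) hK hMτ hM₂ hS ha has hβ hβ3 hβ2 hβε hg
  rw [hres.zeta_eq]
  exact measurable_wOfRecord_zeta316_section θ.A₁ s' V'

end Core

/-! ## §2. At K0a's witness of record `theta13LiveOfRecord` (`εreg = 1`, `cR = 1`, `M = M₂ = 1`, K0b's residuals; the selector clause is `rfl`) -/

section AtRecord

variable (F N)

/-- ★★★ **AT THE WITNESS OF RECORD, PRINT'S BACKGROUND: `¬ SLaw₁₃Co F N θ_live p 1`** on every run with `0 < K`, χ₁-cube side `2((d+5)L+3) ≤ sideχ`, the [B7] Prop. 1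
guard on `ε₀(g₀)`, the Prop. 2 guards on a `β` with `ε₁η₁² + 8δ₀ ≤ βη₁²`, and `SU(N)` non-trivial at the two thresholds — Theorem 1's LEVEL-1 CONCLUSION ITSELF fails at
the record's own inhabitant (every witness letter discharged; only the run's guards remain). [cite: Balaban1988Convergent, Theorem p.245, Thm 1 p.262, (3.16) p.268, (3.22) p.269, (3.25) p.270, (2.10) p.256; Balaban1989LargeFieldI, (0.3)–(0.4) p.176; Balaban1985Averaging, Prop. 1 (51) pp.25–26, Prop. 2 (52)–(54) p.26] -/
theorem not_sLaw₁₃Co_one_theta13LiveOfRecord (p : B12.RunParams) (hK : 0 < p.K)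
    (hS : 2 * ((((F.P p.K).d + 4) * (F.P p.K).L + 2) + (F.P p.K).L + 1) ≤
      sideχ F (theta13LiveOfRecord F N).ν p (gOfRecord₁₃ F N (theta13LiveOfRecord F N) p) 0)
    (ha : 0 < epsOfRecord (theta13LiveOfRecord F N).ν (gOfRecord₁₃ F N (theta13LiveOfRecord F N) p) 0)
    (has : ((((F.P p.K).d + 4) * (F.P p.K).L : ℕ) : ℝ) ^ 2 / 4 * epsOfRecord (theta13LiveOfRecord F N).ν (gOfRecord₁₃ F N (theta13LiveOfRecord F N) p) 0 ≤
      deltaSU (Fin N) / 2)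
    {β : ℝ} (hβ : 0 < β) (hβ3 : (143 * (((((F.P p.K).d + 4 : ℕ) : ℝ)) ^ 2 / 4) ^ 2) * β ≤ 1 / 3)
    (hβ2 : 2 * β ≤ 2 * deltaSU (Fin N) / ((((F.P p.K).d + 4) * (F.P p.K).L : ℕ) : ℝ) ^ 2)
    (hβε : epsOfRecord (theta13LiveOfRecord F N).ν (gOfRecord₁₃ F N (theta13LiveOfRecord F N) p) 1 * (F.P p.K).eta 1 ^ 2 +
        4 * (2 * deltaOfRecord (theta13LiveOfRecord F N).ν (gOfRecord₁₃ F N (theta13LiveOfRecord F N) p) 0 (theta13LiveOfRecord F N).A₁) ≤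
      β * (F.P p.K).eta 1 ^ 2)
    (hg : ∃ g₀ : SU N,
      ((F.P p.K).L : ℝ) ^ 2 * epsOfRecord (theta13LiveOfRecord F N).ν (gOfRecord₁₃ F N (theta13LiveOfRecord F N) p) 0 +
          143 * (((((F.P p.K).d + 4) * (F.P p.K).L : ℕ) : ℝ) ^ 2 / 4 *
            epsOfRecord (theta13LiveOfRecord F N).ν (gOfRecord₁₃ F N (theta13LiveOfRecord F N) p) 0) ^ 2 < dist1 g₀ ∧
        2 * β < dist1 g₀) :
    ¬ SLaw₁₃Co F N (theta13LiveOfRecord F N) p 1 := by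
  have h1 : (theta13LiveOfRecord F N).s2.cR * epsOfRecord (theta13LiveOfRecord F N).ν (gOfRecord₁₃ F N (theta13LiveOfRecord F N) p) 0 =
      epsOfRecord (theta13LiveOfRecord F N).ν (gOfRecord₁₃ F N (theta13LiveOfRecord F N) p) 0 := by
    rw [cR_theta13LiveOfRecord, one_mul]
  refine not_sLaw₁₃Co_one_of_liveSel_of_hasResiduals _ p (hasResidualsOfRecord_theta13LiveOfRecord F N)
    (liveRepin₁₃_liveSel F N
      (theta13OfFamily F N eps0OfRecord₁₃ (zeta316OfRecord F N (numerics7OfFamily eps0OfRecord₁₃) 1 1) (RzOfRecord F N) (ZtOfRecord F N))) hK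
    (Summit.QuantumFields.YangMills.Theorems.BalabanUVNodesN11NoExpansionTermFree.one_le_M_theta13LiveOfFamily F N eps0OfRecord₁₃ _ _ (ZtOfRecord F N))
    le_rfl hS (by rw [h1]; exact ha) (by rw [h1]; exact has) hβ hβ3 hβ2 hβε ?_
  rw [h1]
  exact hg

/-- ★★★ **AT THE GROUP OF RECORD `SU(2)`: `¬ SLaw₁₃Co F 2 θ_live p 1`** on every run with `0 < K` meeting the cube-size condition and the two small-parameter guards
(both thresholds `< 2`; an element at distance `2` exists by n07-e's `su2_dist1_surj`). [cite: Balaban1988Convergent, Theorem p.245, Thm 1 p.262, (3.25) p.270; Balaban1985Averaging, Prop. 1 (51) pp.25–26, Prop. 2 (52)–(54) p.26; Balaban1987RG1, (0.4) p.253] -/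
theorem not_sLaw₁₃Co_one_theta13LiveOfRecord_su2 {F : T4Family} (p : B12.RunParams) (hK : 0 < p.K)
    (hS : 2 * ((((F.P p.K).d + 4) * (F.P p.K).L + 2) + (F.P p.K).L + 1) ≤
      sideχ F (theta13LiveOfRecord F 2).ν p (gOfRecord₁₃ F 2 (theta13LiveOfRecord F 2) p) 0)
    (ha : 0 < epsOfRecord (theta13LiveOfRecord F 2).ν (gOfRecord₁₃ F 2 (theta13LiveOfRecord F 2) p) 0)
    (has : ((((F.P p.K).d + 4) * (F.P p.K).L : ℕ) : ℝ) ^ 2 / 4 * epsOfRecord (theta13LiveOfRecord F 2).ν (gOfRecord₁₃ F 2 (theta13LiveOfRecord F 2) p) 0 ≤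
      deltaSU (Fin 2) / 2)
    (ha2 : ((F.P p.K).L : ℝ) ^ 2 * epsOfRecord (theta13LiveOfRecord F 2).ν (gOfRecord₁₃ F 2 (theta13LiveOfRecord F 2) p) 0 +
        143 * (((((F.P p.K).d + 4) * (F.P p.K).L : ℕ) : ℝ) ^ 2 / 4 *
          epsOfRecord (theta13LiveOfRecord F 2).ν (gOfRecord₁₃ F 2 (theta13LiveOfRecord F 2) p) 0) ^ 2 < 2)
    {β : ℝ} (hβ : 0 < β) (hβ3 : (143 * (((((F.P p.K).d + 4 : ℕ) : ℝ)) ^ 2 / 4) ^ 2) * β ≤ 1 / 3)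
    (hβ2 : 2 * β ≤ 2 * deltaSU (Fin 2) / ((((F.P p.K).d + 4) * (F.P p.K).L : ℕ) : ℝ) ^ 2)
    (hβε : epsOfRecord (theta13LiveOfRecord F 2).ν (gOfRecord₁₃ F 2 (theta13LiveOfRecord F 2) p) 1 * (F.P p.K).eta 1 ^ 2 +
        4 * (2 * deltaOfRecord (theta13LiveOfRecord F 2).ν (gOfRecord₁₃ F 2 (theta13LiveOfRecord F 2) p) 0 (theta13LiveOfRecord F 2).A₁) ≤
      β * (F.P p.K).eta 1 ^ 2) :
    ¬ SLaw₁₃Co F 2 (theta13LiveOfRecord F 2) p 1 := by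
  obtain ⟨g₀, hg₀⟩ := su2_dist1_surj 2 zero_le_two le_rfl
  have hd : (F.P p.K).d = 4 := rfl
  have hβlt : 2 * β < 2 := by
    rw [hd] at hβ3
    norm_num at hβ3
    linarith
  exact not_sLaw₁₃Co_one_theta13LiveOfRecord F 2 p hK hS ha has hβ hβ3 hβ2 hβε ⟨g₀, by rw [hg₀]; exact ha2, by rw [hg₀]; exact hβlt⟩

end AtRecord

end Summit.QuantumFields.YangMills.Theorems.BalabanUVNodesN11NoSLawOneAtAnyLiveWitness

end
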